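import Summits.Ventures.LatticeQCDFlow.Scoring.SchwingerDysonSpectralOracle
import HarnessLib

/-!
# Plane waves are Laplacian eigenmodes: the structure factor `⟨|φ̃(k)|²⟩ = V / (2(m² + k̂²))` of the free lattice field, and its interacting correction

HONEST FRAMING: exact (Metropolis-corrected) sampling algorithms for lattice gauge theory;
figures of merit are autocorrelation/cost numbers at stated couplings and volumes; no
continuum-physics claim.  (SCALAR calibration rung S0-A: not a gauge result.)

Venture `LatticeQCDFlow` (cell pub-lqcd), sub-topic `Scoring`; FANOUT row 2 (`s0-phi4`).  NEW WORK
of the cell.  Discharges the eigenmode hypothesis of `SchwingerDysonSpectralOracle.lean` for PLANE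
WAVES, stated through a phase function: `θ : Λ → ℝ` with `θ(σ_μ x) ≡ θ(x) + k_μ (mod 2π)` for every
direction `μ` and site `x` (the hypothesis `hθ` below; on the periodic `L₀ × … × L_{d−1}` lattice,
`θ(x) = Σ_μ k_μ x_μ` with `k_μ ∈ (2π/L_μ)ℤ` is such a phase — the wrap-around is the `mod 2π`).
Then `cos ∘ θ` and `sin ∘ θ` are eigenmodes of `−Δ_lat` with eigenvalue
`k̂² = Σ_μ (2 − 2 cos k_μ) = Σ_μ 4 sin²(k_μ/2)` (`cos_phase_eigen`, `sin_phase_eigen`,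
`latticeMomSq_eq_four_sin_sq`), `‖cos θ‖² + ‖sin θ‖² = V` (`sum_cos_sq_add_sin_sq`), and the
spectral identities of the companion file become statements about the structure factor
`|φ̃(k)|² := (Σ_y cos θ_y φ_y)² + (Σ_y sin θ_y φ_y)²` of the engine's field (latflow.core
`phi4_2d`, AKS 2019 eq. (3.35), `J = −Δ_lat + m²`):

* **`structure_factor_sd`** (`λ > 0`, any real `m²`):
  `2(k̂² + m²) ⟨|φ̃(k)|²⟩ + 4λ ⟨C_k Σ_y cos θ_y φ_y³ + S_k Σ_y sin θ_y φ_y³⟩ = V`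
  (`C_k = Σ cos θ_y φ_y`, `S_k = Σ sin θ_y φ_y`) — exact, mode by mode, reference-free;
* **`structure_factor_free`** (`λ = 0`, `m² > 0`): `2(k̂² + m²) ⟨|φ̃(k)|²⟩ = V`, i.e.
  (`structure_factor_free_div`) **`⟨|φ̃(k)|²⟩ / V = 1 / (2(m² + k̂²)) = G̃(k)`** — the exactness
  battery's T1 free-field oracle (BATTERY-REPORT.md v1.1), typed;
* `planePhase_finRotate` — the 1-d instance: on the cycle `Fin (n+1)` with the shift `finRotate`,
  `θ_j(x) = 2π j x / (n+1)` is a plane phase with `k = 2π j / (n+1)` for every integer `j`.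

NOT here: the multi-dimensional product-lattice bookkeeping (an enumeration `Fin (L₀L₁) ≃ Fin L₀ ×
Fin L₁` carrying `θ(x) = k₀x₀ + k₁x₁`; the phase hypothesis is all the theorems use); statistical
power (numerics gate).
-/

namespace Summit.Ventures.LatticeQCDFlow.Scoring

open Real MeasureTheory Set Filter Finset

section PlaneWaves

variable {n : ℕ} {ι : Type*} [Fintype ι]

/-! ## Plane phases and the lattice momentum -/

/-- `k̂² = Σ_μ (2 − 2 cos k_μ) = Σ_μ 4 sin²(k_μ/2)` (the half-angle form printed in the engine's
free-field oracle; the one-variable identity is `Real.sin_sq_eq_half_sub`). -/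
theorem latticeMomSq_eq_four_sin_sq (k : ι → ℝ) :
    ∑ μ, (2 - 2 * Real.cos (k μ)) = ∑ μ, 4 * Real.sin (k μ / 2) ^ 2 :=
  Finset.sum_congr rfl fun μ _ => by
    rw [Real.sin_sq_eq_half_sub, show 2 * (k μ / 2) = k μ by ring]
    ring

omit [Fintype ι] in
/-- Backward shift of a plane phase: `θ(σ_μ⁻¹ x) = θ(x) − k_μ (mod 2π)`. -/
theorem planePhase_symm {σ : ι → Equiv.Perm (Fin (n + 1))} {k : ι → ℝ} {θ : Fin (n + 1) → ℝ}
    (hθ : ∀ μ x, ∃ m : ℤ, θ (σ μ x) = θ x + k μ + m * (2 * π)) (μ : ι) (x : Fin (n + 1)) :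
    ∃ m : ℤ, θ ((σ μ).symm x) = θ x - k μ + m * (2 * π) := by
  obtain ⟨m, hm⟩ := hθ μ ((σ μ).symm x)
  rw [Equiv.apply_symm_apply] at hm
  refine ⟨-m, ?_⟩
  push_cast
  linarith

/-- **`cos ∘ θ` is an eigenmode of `−Δ_lat` with eigenvalue `k̂²`.** -/
theorem cos_phase_eigen {σ : ι → Equiv.Perm (Fin (n + 1))} {k : ι → ℝ} {θ : Fin (n + 1) → ℝ}
    (hθ : ∀ μ x, ∃ m : ℤ, θ (σ μ x) = θ x + k μ + m * (2 * π)) (x : Fin (n + 1)) :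
    ∑ μ, (2 * Real.cos (θ x) - Real.cos (θ (σ μ x)) - Real.cos (θ ((σ μ).symm x)))
      = (∑ μ, (2 - 2 * Real.cos (k μ))) * Real.cos (θ x) := by
  rw [Finset.sum_mul]
  refine Finset.sum_congr rfl fun μ _ => ?_
  obtain ⟨m, hm⟩ := hθ μ x
  obtain ⟨m', hm'⟩ := planePhase_symm hθ μ x
  rw [hm, hm', Real.cos_add_int_mul_two_pi, Real.cos_add_int_mul_two_pi, Real.cos_add,
    Real.cos_sub]
  ring

/-- **`sin ∘ θ` is an eigenmode of `−Δ_lat` with eigenvalue `k̂²`.** -/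
theorem sin_phase_eigen {σ : ι → Equiv.Perm (Fin (n + 1))} {k : ι → ℝ} {θ : Fin (n + 1) → ℝ}
    (hθ : ∀ μ x, ∃ m : ℤ, θ (σ μ x) = θ x + k μ + m * (2 * π)) (x : Fin (n + 1)) :
    ∑ μ, (2 * Real.sin (θ x) - Real.sin (θ (σ μ x)) - Real.sin (θ ((σ μ).symm x)))
      = (∑ μ, (2 - 2 * Real.cos (k μ))) * Real.sin (θ x) := by
  rw [Finset.sum_mul]
  refine Finset.sum_congr rfl fun μ _ => ?_
  obtain ⟨m, hm⟩ := hθ μ x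
  obtain ⟨m', hm'⟩ := planePhase_symm hθ μ x
  rw [hm, hm', Real.sin_add_int_mul_two_pi, Real.sin_add_int_mul_two_pi, Real.sin_add,
    Real.sin_sub]
  ring

omit [Fintype ι] in
/-- `‖cos θ‖² + ‖sin θ‖² = V` (`V = n + 1` sites). -/
theorem sum_cos_sq_add_sin_sq (θ : Fin (n + 1) → ℝ) :
    (∑ y, Real.cos (θ y) ^ 2) + ∑ y, Real.sin (θ y) ^ 2 = (n + 1 : ℝ) := by
  rw [← Finset.sum_add_distrib, Finset.sum_congr rfl fun y _ => Real.cos_sq_add_sin_sq (θ y)]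
  simp

/-! ## The structure factor -/

/-- **Interacting structure-factor identity** for the engine's action, `λ > 0`, any real `m²`
(incl. the tachyonic AKS 2019 sets), any plane phase `θ` with wave numbers `k`:
`2(k̂² + m²) ⟨C_k² + S_k²⟩ + 4λ ⟨C_k Σ_y cos θ_y φ_y³ + S_k Σ_y sin θ_y φ_y³⟩ = V`, where
`C_k = Σ_y cos θ_y φ_y`, `S_k = Σ_y sin θ_y φ_y`, `C_k² + S_k² = |φ̃(k)|²`. -/
theorem structure_factor_sd {lam : ℝ} (hlam : 0 < lam) (σ : ι → Equiv.Perm (Fin (n + 1)))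
    (m2 : ℝ) {k : ι → ℝ} {θ : Fin (n + 1) → ℝ}
    (hθ : ∀ μ x, ∃ m : ℤ, θ (σ μ x) = θ x + k μ + m * (2 * π)) :
    2 * ((∑ μ, (2 - 2 * Real.cos (k μ))) + m2) *
        (gibbsExpect (shiftCoupling σ m2) lam (fun φ => (∑ y, Real.cos (θ y) * φ y) ^ 2)
          + gibbsExpect (shiftCoupling σ m2) lam (fun φ => (∑ y, Real.sin (θ y) * φ y) ^ 2))
      + 4 * lam *
        (gibbsExpect (shiftCoupling σ m2) lam
            (fun φ => (∑ y, Real.cos (θ y) * φ y) * ∑ x, Real.cos (θ x) * φ x ^ 3)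
          + gibbsExpect (shiftCoupling σ m2) lam
            (fun φ => (∑ y, Real.sin (θ y) * φ y) * ∑ x, Real.sin (θ x) * φ x ^ 3))
      = (n + 1 : ℝ) := by
  have hc := spectral_sd_shift hlam σ m2 (b := fun y => Real.cos (θ y)) (cos_phase_eigen hθ)
  have hs := spectral_sd_shift hlam σ m2 (b := fun y => Real.sin (θ y)) (sin_phase_eigen hθ)
  rw [← sum_cos_sq_add_sin_sq θ, ← hc, ← hs]
  ring

/-- **The free structure factor** (`λ = 0`, `m² > 0`): `2(k̂² + m²) ⟨|φ̃(k)|²⟩ = V`. -/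
theorem structure_factor_free (σ : ι → Equiv.Perm (Fin (n + 1))) {m2 : ℝ} (hm2 : 0 < m2)
    {k : ι → ℝ} {θ : Fin (n + 1) → ℝ}
    (hθ : ∀ μ x, ∃ m : ℤ, θ (σ μ x) = θ x + k μ + m * (2 * π)) :
    2 * ((∑ μ, (2 - 2 * Real.cos (k μ))) + m2) *
        (gibbsExpect (shiftCoupling σ m2) 0 (fun φ => (∑ y, Real.cos (θ y) * φ y) ^ 2)
          + gibbsExpect (shiftCoupling σ m2) 0 (fun φ => (∑ y, Real.sin (θ y) * φ y) ^ 2))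
      = (n + 1 : ℝ) := by
  have hc := free_spectral_oracle σ hm2 (b := fun y => Real.cos (θ y)) (cos_phase_eigen hθ)
  have hs := free_spectral_oracle σ hm2 (b := fun y => Real.sin (θ y)) (sin_phase_eigen hθ)
  rw [← sum_cos_sq_add_sin_sq θ, ← hc, ← hs]
  ring

/-- `k̂² ≥ 0`. -/
theorem latticeMomSq_nonneg (k : ι → ℝ) : 0 ≤ ∑ μ, (2 - 2 * Real.cos (k μ)) := by
  rw [latticeMomSq_eq_four_sin_sq]
  exact Finset.sum_nonneg fun μ _ => by positivity

/-- **The exactness battery's free-field oracle `G̃(k) = 1 / (2(m² + k̂²))`**, typed: for the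
engine's free field (`λ = 0`, `m² > 0`) and every plane phase,
`⟨|φ̃(k)|²⟩ / V = 1 / (2(m² + k̂²))` with `|φ̃(k)|² = (Σ_y cos θ_y φ_y)² + (Σ_y sin θ_y φ_y)²`,
`k̂² = Σ_μ 4 sin²(k_μ/2)`. -/
theorem structure_factor_free_div (σ : ι → Equiv.Perm (Fin (n + 1))) {m2 : ℝ} (hm2 : 0 < m2)
    {k : ι → ℝ} {θ : Fin (n + 1) → ℝ}
    (hθ : ∀ μ x, ∃ m : ℤ, θ (σ μ x) = θ x + k μ + m * (2 * π)) :
    (gibbsExpect (shiftCoupling σ m2) 0 (fun φ => (∑ y, Real.cos (θ y) * φ y) ^ 2)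
        + gibbsExpect (shiftCoupling σ m2) 0 (fun φ => (∑ y, Real.sin (θ y) * φ y) ^ 2))
      / (n + 1 : ℝ) = 1 / (2 * (m2 + ∑ μ, (2 - 2 * Real.cos (k μ)))) := by
  have h := structure_factor_free σ hm2 hθ
  have hpos : 0 < 2 * (m2 + ∑ μ, (2 - 2 * Real.cos (k μ))) := by
    have := latticeMomSq_nonneg k
    positivity
  have hV : (0 : ℝ) < n + 1 := by positivity
  rw [div_eq_div_iff hV.ne' hpos.ne', one_mul]
  rw [← h]
  ring

/-! ## The 1-d instance: the cycle `Fin (n+1)` with the shift `finRotate` -/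

/-- **Plane phases exist on the cycle**: for the single shift `finRotate (n+1)` (`x ↦ x + 1 mod
n+1`) and every integer `j`, `θ_j(x) = 2π j x/(n+1)` is a plane phase with wave number
`k = 2π j/(n+1)` (the wrap-around at the last site contributes `m = −j`). -/
theorem planePhase_finRotate (j : ℤ) (x : Fin (n + 1)) :
    ∃ m : ℤ, (2 * π * j * ((finRotate (n + 1) x : Fin (n + 1)) : ℕ) / (n + 1) : ℝ)
      = 2 * π * j * (x : ℕ) / (n + 1) + 2 * π * j / (n + 1) + m * (2 * π) := by
  have hV : (0 : ℝ) < n + 1 := by positivity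
  by_cases hx : x = Fin.last n
  · subst hx
    refine ⟨-j, ?_⟩
    have h0 : ((finRotate (n + 1) (Fin.last n) : Fin (n + 1)) : ℕ) = 0 := by
      rw [finRotate_last]
      rfl
    rw [h0, Fin.val_last]
    push_cast
    field_simp
    ring
  · refine ⟨0, ?_⟩
    rw [coe_finRotate_of_ne_last hx]
    push_cast
    ring

end PlaneWaves

end Summit.Ventures.LatticeQCDFlow.Scoring
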